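import Summits.ABC.StewartYu.GenThreeStepOdd
import Summits.ABC.StewartYu.GenThreeInductionOddEngine
import Summits.ABC.StewartYu.GenThreeFrameSpecTwo
import Summits.ABC.StewartYu.GenThreeEndExits
import HarnessLib

/-!
# Cell abc-stewartyu, Gen-3 frame at odd `p` (crux `Y07Odd`, stmt-ABC-19658): the FRAME SPEC — the
# per-rank dichotomy from «extrapolation output + record numerics», typed and proved

`Summits/ABC/StewartYu/GenThreeFrameSpecOdd.lean` — cell `abc-stewartyu` (HOME `run/shared/lean/pub/abc-stewartyu/`),
route `PadicPrimesKummerThird`, seat p4 (g3), engine-support seat; the odd-`p` TWIN of p3-g5's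
`Summits/ABC/StewartYu/GenThreeFrameSpecTwo.lean`.  Two `Prop`-valued predicates (the interface between the
odd-`p` analytic FRAME and the numeric RECORD), theorems.  No named fact, no analytic content.

The frame's OUTPUT predicate is place-free and is REUSED from the twin by name:
`GenThreeFrameSpecTwo.FrameOutputTwo n α b j₀ D₀ S₀ X D` (a nonzero Laurent polynomial
`P = ∑ q(a,κ) Y₀^a Y^κ`, `a ≤ D₀`, `|κⱼ| ≤ Dⱼ`, whose `𝔚`-derivatives of total order `≤ (n+1)S₀` vanish at
the points `(x, αˣ)`, `|x| ≤ (n+1)X` — the scalar identities (5.4) = the `hL` input of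
`GenThreeEndExits.exists_exits_rat`), as is the `b`-hyperplane `GenThreeFrameSpecTwo.bHyperplane`.  What is
odd-`p`-specific:

* `RecordOdd C p n V Vmax W D₀ S₀ X D` — the RECORD's obligations for the parameters (Yu 2013 (3.1)–(3.9)
  at odd `p`, Nesterenko (5.14)–(5.17), Lemma 5.4, (5.22)): exit A numerically impossible; exit B/C with
  `r = n` impossible; for `0 < r < n` the exit-C inequality implies the (5.22) cost line of
  `GenThreeStepOdd.stepOdd_of_exitC` (with its `log p` summand) for every non-singular `r × r` minor;
* `FrameOdd C p n` — for every rank-`n` datum of `GenThreeInductionOdd.CoreOdd` (units, independence,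
  signed `2`-Kummer, weights with floor `1`, `1 ≤ W`) under the NEGATED odd-`p` bound, SOME pivot and
  parameters with `FrameOutputTwo ∧ RecordOdd`.

Theorems: `dichotomyOdd_of_frame : Nesterenko2003_prop51 → (∀ r, 0 ≤ C r) → FrameOdd C p n → DichotomyOdd C p n`
and the end-to-end reduction **`engineOdd_of_frame`: the frozen `GenThreeEngineOdd` text from
`Nesterenko2003_prop51`, an admissible `C ≤ c₁ⁿ`, and `∀ p prime ≠ 2, ∀ n, FrameOdd C p n`** — so the F-odd
lead's remaining work on `stub_engineOdd` is literally `∀ p prime ≠ 2, ∀ n, FrameOdd C p n` for one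
explicit `C` (and `Nesterenko2003_prop51` is the tree theorem `Nesterenko2003_prop51_holds`, p466954).

WHAT THIS IS NOT: the frame and the record themselves; no crux moves.

References: Yu. V. Nesterenko, LNM 1819 (2003), §5.1 (5.4)–(5.8), §5.2 (5.9)–(5.17), (5.22), Lemma 5.4;
K. Yu, Forum Math. 19 (2007); K. Yu, Acta Math. 211 (2013), §3.1, §5, §6.
-/

noncomputable section

open Finset
open Literature.NumberTheory.Transcendental
open Literature.NumberTheory.Transcendental.GaGm

namespace Summit.ABC.StewartYu.GenThreeFrameSpecOdd

open Summit.ABC.StewartYu.GenThreeInductionOdd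
open Summit.ABC.StewartYu.GenThreeStepOdd
open Summit.ABC.StewartYu.GenThreeEndExits
open Summit.ABC.StewartYu.GenThreeFrameSpecTwo (bHyperplane mem_bHyperplane FrameOutputTwo)

variable {p n : ℕ}

/-! ### The record's deliverable at odd `p`, as a predicate -/

/-- **RECORD OBLIGATIONS at rank `n`, odd `p`** for the parameters `(D₀, S₀, X, D)` and the weights:
(A) exit A of the zero estimate is numerically impossible ((5.14)–(5.17)); (B) exit B/C with a character
lattice of full rank `r = n` is impossible (Lemma 5.4); (C) for `0 < r < n`, the exit-C inequality implies
the (5.22) cost line of `GenThreeStepOdd.stepOdd_of_exitC` (with the `log p` summand) for every non-singular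
`r × r` minor `κ`. [cite: Nesterenko2003, §5.2 (5.14)–(5.17), Lemma 5.4, (5.22)] -/
def RecordOdd (C : ℕ → ℝ) (p n : ℕ) (V : Fin n → ℝ) (Vmax W : ℝ) (D₀ S₀ X : ℕ) (D : Fin n → ℕ) :
    Prop :=
  (∀ (r d₀ : ℕ) (M : Matrix (Fin r) (Fin n) ℤ), r ≤ n → d₀ ≤ 1 →
      LinearIndependent ℤ (fun i => M i) →
      ¬ (Nat.choose (S₀ + (r + 1 - d₀)) (r + 1 - d₀) * (2 * X + 1) * nesterenkoH n r d₀ M D₀ D ≤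
          (n + 1).factorial * 2 ^ n * D₀ * ∏ j, D j)) ∧
  (∀ (d₀ : ℕ) (M : Matrix (Fin n) (Fin n) ℤ), d₀ ≤ 1 → LinearIndependent ℤ (fun i => M i) →
      ¬ (Nat.choose (S₀ + (n - d₀)) (n - d₀) * (2 * X + 1) * nesterenkoH n n d₀ M D₀ D ≤
          (n + 1).factorial * 2 ^ n * D₀ * ∏ j, D j)) ∧
  (∀ (r d₀ : ℕ) (M : Matrix (Fin r) (Fin n) ℤ), 0 < r → r < n → d₀ ≤ 1 →
      LinearIndependent ℤ (fun i => M i) →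
      Nat.choose (S₀ + (r - d₀)) (r - d₀) * (2 * X + 1) * nesterenkoH n r d₀ M D₀ D ≤
          (n + 1).factorial * 2 ^ n * D₀ * ∏ j, D j →
      ∀ κ : Fin r → Fin n, Function.Injective κ →
        (Matrix.of fun i j => (M j (κ i) : ℝ)).det ≠ 0 →
        C r * (((r.factorial : ℝ)) ^ 2 * (n : ℝ) ^ r *
                (|(Matrix.of fun i j => (M j (κ i) : ℝ)).det| * ∏ i, V (κ i))) *
            (W + Real.log 3 + Real.log n + Real.log Vmax +
              Real.log (((r.factorial : ℝ)) ^ 2 * (n : ℝ) ^ r *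
                (|(Matrix.of fun i j => (M j (κ i) : ℝ)).det| * ∏ i, V (κ i))) +
              Real.log p +
              Real.log (2 * (((r.factorial : ℝ)) ^ 2 * (n : ℝ) ^ r *
                (|(Matrix.of fun i j => (M j (κ i) : ℝ)).det| * ∏ i, V (κ i))))) ≤
          C n * (∏ j, V j) * (W + Real.log p + Real.log (2 * Vmax)))

/-- **THE FRAME at rank `n`, odd `p`** (what the F-odd lead still owes for `stub_engineOdd`, per rank and
prime): for every rank-`n` datum of the internal statement `CoreOdd` under the NEGATED bound, a pivot
`b j₀ ≠ 0` and parameters with the (place-free) frame output and the odd-`p` record obligations.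
[cite: Nesterenko2003, §5; shape only] -/
def FrameOdd (C : ℕ → ℝ) (p n : ℕ) : Prop :=
  ∀ (α : Fin n → ℚ) (b : Fin n → ℤ) (V : Fin n → ℝ) (Vmax W : ℝ),
    (∀ j, α j ≠ 0 ∧ padicValRat p (α j) = 0) →
    (∀ μ : Fin n → ℤ, ∏ j, α j ^ μ j = 1 → μ = 0) →
    (∀ κ : Fin n → ℤ, (∃ γ : ℚ, ∏ j, α j ^ κ j = γ ^ 2 ∨ ∏ j, α j ^ κ j = -γ ^ 2) →
      ∀ j, (2 : ℤ) ∣ κ j) →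
    (∀ j, Height.logHeight₁ (α j) ≤ V j) → (∀ j, 1 ≤ V j) → (∀ j, V j ≤ Vmax) →
    b ≠ 0 → (∀ j, Real.log (max 3 (|b j| : ℝ)) ≤ W) → 1 ≤ W →
    ¬ (padicValRat p (∏ j, α j ^ b j - 1) : ℝ) * Real.log p ≤
        C n * ((p : ℝ) / Real.log p) * (∏ j, V j) * (W + Real.log p + Real.log (2 * Vmax)) →
    ∃ (j₀ : Fin n) (D₀ S₀ X : ℕ) (D : Fin n → ℕ), b j₀ ≠ 0 ∧
      FrameOutputTwo n α b j₀ D₀ S₀ X D ∧ RecordOdd C p n V Vmax W D₀ S₀ X D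

/-! ### Composition -/

/-- **The per-rank dichotomy at odd `p` from the frame.**  Zero estimate (named fact, now the tree theorem
`Nesterenko2003_prop51_holds`) + frame output ⇒ the END with exits (`exists_exits_rat` on
`𝔚 = bHyperplane b`); exit A and full rank are refuted by the record; exit C with `0 < r < n` is the Matveev
step (`stepOdd_of_exitC`) closed by the record's (5.22) line. [cite: Nesterenko2003, §5.2] -/
theorem dichotomyOdd_of_frame [Fact p.Prime] (hZ : Nesterenko2003_prop51) {C : ℕ → ℝ}
    (hC0 : ∀ r, 0 ≤ C r) (hF : FrameOdd C p n) : DichotomyOdd C p n := by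
  classical
  refine dichotomyOdd_of_not_le ?_
  intro α b V Vmax W hα hind hK hV hV1 hVmax hb hW hW1 hneg
  obtain ⟨j₀, D₀, S₀, X, D, hbj₀, hout, hrecA, hrecB, hrecC⟩ :=
    hF α b V Vmax W hα hind hK hV hV1 hVmax hb hW hW1 hneg
  obtain ⟨I, q, i₀, ha, hκ, hi₀, hq, hL⟩ := hout
  have hα0 : ∀ j, α j ≠ 0 := fun j => (hα j).1
  have hinj : Set.InjOn (fun i : ℕ × (Fin n → ℤ) => (i.1, i.2)) (I : Set (ℕ × (Fin n → ℤ))) := by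
    intro x _ y _ h
    exact Prod.ext (congrArg Prod.fst h) (congrArg Prod.snd h)
  obtain ⟨H, r, M, hrn, hd, hM, hchars, hexits⟩ :=
    exists_exits_rat hZ α hα0 hind b j₀ hbj₀ (bHyperplane b) (mem_bHyperplane b) I Prod.fst Prod.snd q
      D₀ S₀ X D ha hκ hinj hi₀ hq hL
  rcases hexits with ⟨_hnex, hineqA⟩ | ⟨hex, hineqC⟩
  · -- exit A: refuted by the record
    exact absurd hineqA (hrecA r H.addDim M hrn hd hM)
  · -- exit B/C
    rcases Nat.lt_or_ge r n with hlt | hge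
    · -- `r < n`: Matveev's step
      have hr0 : 0 < r := pos_of_exitC b hb (fun i => M i) hex
      have hbM := span_rat_of_exitC b (fun i => M i) hex
      exact stepOdd_of_exitC hr0 hlt (hC0 r) α hα hind hK V Vmax W hV hV1 hVmax b hb hW hW1 H
        (fun i => M i) hM hchars hbM (hrecC r H.addDim M hr0 hlt hd hM hineqC)
    · -- `r = n`: refuted by the record (Lemma 5.4)
      have hrn' : r = n := le_antisymm hrn hge
      subst hrn'
      exact absurd hineqC (hrecB H.addDim M hd hM)

/-- **END-TO-END: the frozen `GenThreeEngineOdd` text from the zero estimate, an admissible constant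
function and the frame at every rank and every odd prime.**  This is the registered stub
`stub_engineOdd : Nesterenko2003_prop51 → GenThreeEngineOdd` of the crux `Y07Odd` reduced to
`∀ p prime ≠ 2, ∀ n, FrameOdd C p n`. [cite: Yu2007, Main Thm (K = ℚ); shape only] -/
theorem engineOdd_of_frame {C : ℕ → ℝ} {c₁ : ℝ} (hc₁ : 1 ≤ c₁) (hC : ∀ m, 0 ≤ C m ∧ C m ≤ c₁ ^ m)
    (hF : Nesterenko2003_prop51 → ∀ p : ℕ, p.Prime → p ≠ 2 → ∀ n, FrameOdd C p n)
    (hZ : Nesterenko2003_prop51) :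
    ∃ (C : ℕ → ℝ) (c₁ : ℝ), 1 ≤ c₁ ∧ (∀ m, 0 ≤ C m ∧ C m ≤ c₁ ^ m) ∧
      ∀ (p : ℕ), p.Prime → p ≠ 2 → ∀ (m : ℕ) (α : Fin m → ℚ) (b : Fin m → ℤ) (V : Fin m → ℝ)
        (Vmax W : ℝ),
        (∀ j, α j ≠ 0 ∧ padicValRat p (α j) = 0) →
        (∀ μ : Fin m → ℤ, ∏ j, α j ^ μ j = 1 → μ = 0) →
        (∀ T : Finset (Fin m), T.Nonempty → ¬ IsSquare (∏ j ∈ T, α j) ∧ ¬ IsSquare (-∏ j ∈ T, α j)) →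
        (∀ j, Height.logHeight₁ (α j) ≤ V j) → (∀ j, Real.log 2 ≤ V j) → (∀ j, V j ≤ Vmax) →
        b ≠ 0 → (∀ j, Real.log (max 3 (|b j| : ℝ)) ≤ W) →
        (padicValRat p (∏ j, α j ^ b j - 1) : ℝ) * Real.log p ≤
          C m * ((p : ℝ) / Real.log p) * (∏ j, V j) * (W + Real.log p + Real.log (2 * Vmax)) :=
  engineOdd_of_dichotomy hc₁ hC
    (fun hZ' p hp hp2 n => by
      haveI : Fact p.Prime := ⟨hp⟩
      exact dichotomyOdd_of_frame hZ' (fun r => (hC r).1) (hF hZ' p hp hp2 n)) hZ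

end Summit.ABC.StewartYu.GenThreeFrameSpecOdd

end
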